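import Literature.NumberTheory.LFunctions.SiegelZeroExceptionalPrimeSums
import Literature.NumberTheory.LFunctions.ExceptionalPrimesSparse
import Literature.NumberTheory.LFunctions.SiegelZeroExceptionalPrimesSecond
import Literature.NumberTheory.LFunctions.SiegelZeroLacunaryDivisorSums
import HarnessLib

/-!
# Discharges of `heathBrown1983_lemma3` and `taoTeravainen2022_proposition35`
# (the named facts of `SiegelZeroExceptionalPrimeSums.lean`) from the tree's proved theorems

Topic `Literature/NumberTheory/LFunctions`, namespace `Literature.NumberTheory.LFunctions`.
THEOREMS ONLY (no definitions, no named facts, no new hypotheses).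

The statement file `SiegelZeroExceptionalPrimeSums.lean` (cell ls-idea, 2026-08-27/28) vendored, as
NAMED FACTS in Tao–Teräväinen's normalisation (quality `η ≥ 10`, sums over the primes with
`χ(p) = 1`),

* `taoTeravainen2022_proposition35` — Tao–Teräväinen, J. London Math. Soc. (2) 106 (2022),
  Proposition 3.5, both bounds (3.22)–(3.23) (= arXiv:2109.06291 (3.13)–(3.14)), and
* `heathBrown1983_lemma3` — Heath-Brown, PLMS (3) 47 (1983), Lemma 3, as quoted in (3.20) there,

while the tree already PROVES both results, in the sibling normalisations of
`SiegelZeroExceptionalPrimes.lean` / `SiegelZeroExceptionalPrimesProofs.lean` /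
`SiegelZeroExceptionalPrimesSecond.lean` (`SiegelZero.TaoTeravainen2021_eq313_holds`,
`SiegelZero.TaoTeravainen2021_eq314_holds`: for every `ε > 0` there are `K, η₀` such that the bounds
hold for `η ≥ η₀`, the sums running over ALL exceptional primes `χ(p*) ≠ −1`) and of
`ExceptionalPrimesSparse.lean` (`SiegelZero.HeathBrown1983_lemma3`: absolute `C > 0`, every `η ≥ 3`,
sum over `(Nat.primesLE (q^500)).filter (χ · = 1)`). This file closes the two named facts from those
theorems (three, with the append):

* `heathBrown1983_lemma3_holds : heathBrown1983_lemma3` — pure re-indexing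
  (`Nat.primesLE N = (Icc 1 N).filter Nat.Prime`), `η ≥ 10 ≥ 3`;
* `matomakiMerikoski2023_lemma22_holds : matomakiMerikoski2023_lemma22` (APPENDED 2026-08-29) —
  Matomäki–Merikoski 2023 Lemma 2.2 (the `z`-rough form) is PROVED in the tree as
  `SiegelZero.MatomakiMerikoski2023_lemma22` (`SiegelZeroLacunaryDivisorSums.lean`, §4 of the source:
  squarefree part `≤ exp(Σ_{z≤p≤Y} λ(p)/p) − 1`, non-squarefree part `≪ z⁻¹(log Y/log z)²`, Lemma 4.1);
  the two renderings differ only in bookkeeping — `(m, P(z)) = 1` as `m.Coprime (primesProdBelow z)`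
  versus "every prime factor of `m` is `≥ z`", and `λ = RealChar.charDivisorSum χ` versus `rDivisorSum χ`;
* `taoTeravainen2022_proposition35_holds : taoTeravainen2022_proposition35` — for `η ≥ η₀(ε)` the
  tree's theorems (the primes with `χ(p) = 1` are among those with `χ(p) ≠ −1`, all terms `1/p ≥ 0`);
  for `10 ≤ η < η₀(ε)` the bounds are TRIVIAL, the quality being bounded in terms of `ε`: by the
  Chebyshev–Mertens bound `∑_{p ≤ n} (log p)/p ≤ log n + log 4` of the tree
  (`MertensBound.sum_log_div_prime_le`) and `1/p ≤ ((log p)/p)/log a` for `p > a > 1`,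
  `∑_{a < p ≤ b} 1/p ≤ (log b + log 4)/log a` (`sum_inv_le_of_primes_gt`); with `a = q^{(1+ε)/2}`,
  `b = x` this is `≤ 10 log x/log q ≤ (10 η₀/η) log x/log q`, and with `a = q^{(1+ε)/(2m)}`,
  `b = q^{(1+ε)/(2(m−1))}` it is `≤ m/(m−1) + 2m log 4/((1+ε) log q) ≤ 5m ≤ (10 η₀) m/η^{1/m}`
  (`η^{1/m} ≤ η < η₀`). This is exactly the device of the printed source for bounded quality
  ("we will also assume that `η` is sufficiently large depending on the fixed quantities", §2.1 of
  arXiv:2109.06291), made explicit.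

Nothing here asserts that a Siegel zero exists; the constants are ineffective exactly as in print
(Siegel's theorem inside the tree's proofs).

## References

* [TaoTeravainen2022SiegelZero] T. Tao, J. Teräväinen, *The Hardy–Littlewood–Chowla conjecture in
  the presence of a Siegel zero*, J. London Math. Soc. (2) 106 (2022) 3317–3378, Proposition 3.5,
  §3.3 (3.20); arXiv:2109.06291 §2.1, §3.3.
* [HeathBrown1983PrimeTwins] D. R. Heath-Brown, *Prime twins and Siegel zeros*, Proc. London Math.
  Soc. (3) 47 (1983) 193–224, Lemma 3.
* [HardyWright2008] G. H. Hardy, E. M. Wright, *An Introduction to the Theory of Numbers*, Thm 425.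
* [MatomakiMerikoski2023] K. Matomäki, J. Merikoski, *Siegel zeros, twin primes, Goldbach's conjecture,
  and primes in short intervals*, IMRN 2023, arXiv:2112.11412, Lemma 2.2 and §4 (pp. 14–15).
-/

noncomputable section

open Finset

namespace Literature.NumberTheory.LFunctions

/-! ### Heath-Brown's Lemma 3 -/

/-- Re-indexing: the logarithmic exceptional-prime sum of `SiegelZeroExceptionalPrimeSums.lean` is the
sum over `(Nat.primesLE N).filter (χ · = 1)` of `ExceptionalPrimesSparse.lean`. [folklore] -/
private theorem exceptionalPrimeLogSum_eq_sum_primesLE {q : ℕ} (χ : DirichletCharacter ℂ q) (N : ℕ) :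
    exceptionalPrimeLogSum χ N =
      ∑ p ∈ (Nat.primesLE N).filter (fun p : ℕ => χ (p : ZMod q) = 1), Real.log p / p := by
  unfold exceptionalPrimeLogSum
  rw [Nat.primesLE_eq_filter_Icc_one, Finset.filter_filter]

/-- **Heath-Brown 1983, Lemma 3 — DISCHARGED** (from the tree's theorem
`SiegelZero.HeathBrown1983_lemma3`, `ExceptionalPrimesSparse.lean`, valid for every `η ≥ 3`).
[cite: HeathBrown1983PrimeTwins, Lemma 3 (as quoted in TaoTeravainen2022SiegelZero (3.20))] -/
theorem heathBrown1983_lemma3_holds : heathBrown1983_lemma3 := by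
  obtain ⟨C, _, H⟩ := SiegelZero.HeathBrown1983_lemma3
  refine ⟨C, fun q _ χ _ hprim hquad η hη h0 => ?_⟩
  rw [exceptionalPrimeLogSum_eq_sum_primesLE]
  exact H q χ hprim hquad η (by linarith) h0

/-! ### The trivial regime: `∑_{a < p ≤ b} 1/p ≤ (log b + log 4)/log a` -/

/-- For a finite set `s` of primes `p` with `a < p ≤ B` (`a > 1` real, `B` natural):
`∑_{p ∈ s} 1/p ≤ (log B + log 4)/log a`, by `1/p ≤ ((log p)/p)/log a` and the Chebyshev–Mertens bound
`∑_{p ≤ B} (log p)/p ≤ log B + log 4` (`MertensBound.sum_log_div_prime_le`).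
[cite: HardyWright2008, Thm 425] -/
theorem sum_inv_le_of_primes_gt {a : ℝ} (ha : 1 < a) (B : ℕ) (s : Finset ℕ)
    (hs : ∀ p ∈ s, p.Prime ∧ a < p ∧ p ≤ B) :
    ∑ p ∈ s, (1 : ℝ) / p ≤ (Real.log B + Real.log 4) / Real.log a := by
  have hloga : 0 < Real.log a := Real.log_pos ha
  have hsub : s ⊆ Nat.primesLE B := fun p hp => Nat.mem_primesLE.mpr ⟨(hs p hp).2.2, (hs p hp).1⟩
  have h1 : ∑ p ∈ s, (1 : ℝ) / p ≤ ∑ p ∈ s, (Real.log p / p) / Real.log a := by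
    refine Finset.sum_le_sum fun p hp => ?_
    obtain ⟨hpr, hap, _⟩ := hs p hp
    have hp0 : (0 : ℝ) < p := by exact_mod_cast hpr.pos
    have hlogp : Real.log a ≤ Real.log p := Real.log_le_log (by linarith) hap.le
    rw [div_div, div_le_div_iff₀ hp0 (mul_pos hp0 hloga), one_mul]
    calc (p : ℝ) * Real.log a ≤ p * Real.log p := by gcongr
      _ = Real.log p * p := by ring
  have h2 : ∑ p ∈ s, (Real.log p / p) / Real.log a ≤
      ∑ p ∈ Nat.primesLE B, (Real.log p / p) / Real.log a := by
    refine Finset.sum_le_sum_of_subset_of_nonneg hsub fun p hp _ => ?_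
    have hp1 : (1 : ℝ) ≤ p := by exact_mod_cast (Nat.mem_primesLE.mp hp).2.one_lt.le
    exact div_nonneg (div_nonneg (Real.log_nonneg hp1) (by linarith)) hloga.le
  refine h1.trans (h2.trans ?_)
  rw [← Finset.sum_div]
  exact div_le_div_of_nonneg_right (MertensBound.sum_log_div_prime_le B) hloga.le

/-- The trivial bound for the exceptional-prime harmonic sum on `(a, b]`, `1 < a`, `1 ≤ b`:
`∑_{a < p ≤ b, χ(p) = 1} 1/p ≤ (log b + log 4)/log a`. [cite: HardyWright2008, Thm 425] -/
theorem exceptionalPrimeHarmonicSum_le_trivial {q : ℕ} (χ : DirichletCharacter ℂ q) {a b : ℝ}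
    (ha : 1 < a) (hb : 1 ≤ b) :
    exceptionalPrimeHarmonicSum χ a b ≤ (Real.log b + Real.log 4) / Real.log a := by
  have hloga : 0 < Real.log a := Real.log_pos ha
  have hB1 : 1 ≤ ⌊b⌋₊ := Nat.le_floor (by exact_mod_cast hb)
  have hlogB : Real.log (⌊b⌋₊ : ℕ) ≤ Real.log b := by
    have h0 : (0 : ℝ) < (⌊b⌋₊ : ℕ) := by exact_mod_cast hB1
    exact Real.log_le_log h0 (Nat.floor_le (by linarith))
  unfold exceptionalPrimeHarmonicSum
  refine (sum_inv_le_of_primes_gt ha ⌊b⌋₊ _ fun p hp => ?_).trans ?_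
  · simp only [Finset.mem_filter, Finset.mem_Ioc] at hp
    refine ⟨hp.2.1, ?_, hp.1.2⟩
    have : ⌊a⌋₊ < p := hp.1.1
    exact (Nat.floor_lt (by linarith)).mp this
  · exact div_le_div_of_nonneg_right (by linarith) hloga.le

/-! ### Tao–Teräväinen's Proposition 3.5 -/

/-- The primes with `χ(p) = 1` in `(⌊a⌋, ⌊b⌋]` are among Tao–Teräväinen's exceptional primes
`χ(p*) ≠ −1` there, so the harmonic sum of `SiegelZeroExceptionalPrimeSums.lean` is at most the one of
`SiegelZeroExceptionalPrimes.lean`. [cite: TaoTeravainen2022SiegelZero, §2.3 and footnote 5] -/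
theorem exceptionalPrimeHarmonicSum_le_sum_excPrimes {q : ℕ} (χ : DirichletCharacter ℂ q) (a b : ℝ) :
    exceptionalPrimeHarmonicSum χ a b ≤ ∑ p ∈ SiegelZero.excPrimes χ (Ioc ⌊a⌋₊ ⌊b⌋₊), (1 : ℝ) / p := by
  unfold exceptionalPrimeHarmonicSum
  refine Finset.sum_le_sum_of_subset_of_nonneg (fun p hp => ?_) fun p _ _ => by positivity
  simp only [Finset.mem_filter] at hp
  refine SiegelZero.mem_excPrimes.mpr ⟨hp.1, hp.2.1, ?_⟩
  rw [hp.2.2]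
  norm_num

set_option maxHeartbeats 400000 in
/-- **Tao–Teräväinen 2022, Proposition 3.5 — DISCHARGED** (from the tree's theorems
`SiegelZero.TaoTeravainen2021_eq313_holds`, `SiegelZero.TaoTeravainen2021_eq314_holds` for
`η ≥ η₀(ε)`, and the trivial Chebyshev–Mertens bound for `10 ≤ η < η₀(ε)`).
[cite: TaoTeravainen2022SiegelZero, Proposition 3.5 (3.22)–(3.23)] -/
theorem taoTeravainen2022_proposition35_holds : taoTeravainen2022_proposition35 := by
  intro ε hε
  obtain ⟨K₁, η₁, H₁⟩ := SiegelZero.TaoTeravainen2021_eq313_holds ε hε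
  obtain ⟨K₂, η₂, H₂⟩ := SiegelZero.TaoTeravainen2021_eq314_holds ε hε
  set η₀ : ℝ := max (max η₁ η₂) 10 with hη₀def
  have hη₀1 : η₁ ≤ η₀ := (le_max_left _ _).trans (le_max_left _ _)
  have hη₀2 : η₂ ≤ η₀ := (le_max_right _ _).trans (le_max_left _ _)
  have hη₀10 : 10 ≤ η₀ := le_max_right _ _
  refine ⟨max (max K₁ K₂) (10 * η₀), fun q _ χ _ hprim hquad η hη h0 => ?_⟩
  have hK₁ : K₁ ≤ max (max K₁ K₂) (10 * η₀) := (le_max_left _ _).trans (le_max_left _ _)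
  have hK₂ : K₂ ≤ max (max K₁ K₂) (10 * η₀) := (le_max_right _ _).trans (le_max_left _ _)
  have hK₀ : 10 * η₀ ≤ max (max K₁ K₂) (10 * η₀) := le_max_right _ _
  have hq2 : 2 ≤ q := SiegelZero.two_le_of_LFunction_eq_zero h0
  have hq : (2 : ℝ) ≤ q := by exact_mod_cast hq2
  have hlogq : Real.log 2 ≤ Real.log q := Real.log_le_log two_pos hq
  have hlog2 : (0 : ℝ) < Real.log 2 := Real.log_pos one_lt_two
  have hlogq0 : 0 < Real.log q := hlog2.trans_le hlogq
  have hlog4 : Real.log 4 = 2 * Real.log 2 := by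
    rw [show (4 : ℝ) = 2 ^ 2 by norm_num, Real.log_pow]; norm_num
  have hη0 : 0 < η := by linarith
  have hq1 : (1 : ℝ) < q := by linarith
  constructor
  · -- (3.22)
    intro x hx
    have hε2 : 0 < (1 + ε) / 2 := by positivity
    have ha1 : 1 < (q : ℝ) ^ ((1 + ε) / 2) := Real.one_lt_rpow hq1 hε2
    have hx1 : 1 ≤ x := ha1.le.trans hx
    have hloga : Real.log ((q : ℝ) ^ ((1 + ε) / 2)) = (1 + ε) / 2 * Real.log q :=
      Real.log_rpow (by positivity) _
    have hlogx : (1 + ε) / 2 * Real.log q ≤ Real.log x := by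
      rw [← hloga]; exact Real.log_le_log (by positivity) hx
    have hlogx0 : 0 ≤ Real.log x := Real.log_nonneg hx1
    have hmain0 : 0 ≤ Real.log x / Real.log q / η := by positivity
    rcases le_or_gt η₀ η with hη' | hη'
    · -- large quality: the tree's theorem
      have h := H₁ q χ hprim hquad η (hη₀1.trans hη') h0 x hx
      calc exceptionalPrimeHarmonicSum χ ((q : ℝ) ^ ((1 + ε) / 2)) x
          ≤ _ := exceptionalPrimeHarmonicSum_le_sum_excPrimes χ _ _
        _ ≤ K₁ * (Real.log x / Real.log q) / η := h
        _ = K₁ * (Real.log x / Real.log q / η) := by ring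
        _ ≤ max (max K₁ K₂) (10 * η₀) * (Real.log x / Real.log q / η) :=
          mul_le_mul_of_nonneg_right hK₁ hmain0
        _ = _ := by ring
    · -- bounded quality: trivial bound
      have ht := exceptionalPrimeHarmonicSum_le_trivial χ ha1 hx1
      rw [hloga] at ht
      -- `(log x + log 4)/((1+ε)/2 log q) ≤ 10 log x / log q`
      have hlx : Real.log 2 / 2 ≤ Real.log x := by
        refine le_trans ?_ hlogx
        have : Real.log 2 / 2 ≤ (1 + ε) / 2 * Real.log 2 := by nlinarith
        exact this.trans (by gcongr)
      have h5 : Real.log x + Real.log 4 ≤ 5 * Real.log x := by rw [hlog4]; linarith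
      have hstep : (Real.log x + Real.log 4) / ((1 + ε) / 2 * Real.log q) ≤
          10 * (Real.log x / Real.log q) := by
        rw [div_le_iff₀ (by positivity)]
        calc Real.log x + Real.log 4 ≤ 5 * Real.log x := h5
          _ ≤ 5 * Real.log x * (1 + ε) := by nlinarith
          _ = 10 * (Real.log x / Real.log q) * ((1 + ε) / 2 * Real.log q) := by
            field_simp; ring
      have hη'' : 10 * (Real.log x / Real.log q) ≤
          10 * η₀ * (Real.log x / Real.log q) / η := by
        rw [le_div_iff₀ hη0]
        have : 0 ≤ 10 * (Real.log x / Real.log q) := by positivity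
        nlinarith
      calc exceptionalPrimeHarmonicSum χ ((q : ℝ) ^ ((1 + ε) / 2)) x
          ≤ 10 * (Real.log x / Real.log q) := ht.trans hstep
        _ ≤ 10 * η₀ * (Real.log x / Real.log q) / η := hη''
        _ ≤ max (max K₁ K₂) (10 * η₀) * (Real.log x / Real.log q) / η := by
          gcongr
  · -- (3.23)
    intro m hm
    have hm1 : (1 : ℝ) ≤ m := by exact_mod_cast (by omega : 1 ≤ m)
    have hm2 : (2 : ℝ) ≤ m := by exact_mod_cast hm
    have hm0 : (0 : ℝ) < m := by positivity
    have hmpos : (0 : ℝ) < (m : ℝ) - 1 := by linarith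
    have hεa : 0 < (1 + ε) / (2 * (m : ℝ)) := by positivity
    have hεb : 0 < (1 + ε) / (2 * ((m : ℝ) - 1)) := by positivity
    have ha1 : 1 < (q : ℝ) ^ ((1 + ε) / (2 * (m : ℝ))) := Real.one_lt_rpow hq1 hεa
    have hb1 : 1 ≤ (q : ℝ) ^ ((1 + ε) / (2 * ((m : ℝ) - 1))) := (Real.one_lt_rpow hq1 hεb).le
    have hηm0 : 0 < η ^ ((1 : ℝ) / m) := Real.rpow_pos_of_pos hη0 _
    have hmain0 : 0 ≤ (m : ℝ) / η ^ ((1 : ℝ) / m) := by positivity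
    rcases le_or_gt η₀ η with hη' | hη'
    · have h := H₂ q χ hprim hquad η (hη₀2.trans hη') h0 m hm
      calc exceptionalPrimeHarmonicSum χ ((q : ℝ) ^ ((1 + ε) / (2 * (m : ℝ))))
            ((q : ℝ) ^ ((1 + ε) / (2 * ((m : ℝ) - 1))))
          ≤ _ := exceptionalPrimeHarmonicSum_le_sum_excPrimes χ _ _
        _ ≤ K₂ * m / η ^ ((1 : ℝ) / m) := h
        _ = K₂ * ((m : ℝ) / η ^ ((1 : ℝ) / m)) := by ring
        _ ≤ max (max K₁ K₂) (10 * η₀) * ((m : ℝ) / η ^ ((1 : ℝ) / m)) :=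
          mul_le_mul_of_nonneg_right hK₂ hmain0
        _ = _ := by ring
    · have ht := exceptionalPrimeHarmonicSum_le_trivial χ ha1 hb1
      rw [Real.log_rpow (by positivity), Real.log_rpow (by positivity)] at ht
      -- the trivial bound is `≤ 5m`
      have hstep : ((1 + ε) / (2 * ((m : ℝ) - 1)) * Real.log q + Real.log 4) /
          ((1 + ε) / (2 * (m : ℝ)) * Real.log q) ≤ 5 * m := by
        rw [div_le_iff₀ (by positivity), hlog4]
        -- `m/(m-1) ≤ 2` and `2 log 2 · 2m ≤ 4m (1+ε) log q`... spelled out polynomially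
        have e1 : (1 + ε) / (2 * ((m : ℝ) - 1)) * Real.log q ≤ (1 + ε) / (m : ℝ) * Real.log q := by
          apply mul_le_mul_of_nonneg_right _ hlogq0.le
          rw [div_le_div_iff₀ (by positivity) hm0]
          nlinarith
        have hAm : (1 + ε) / (2 * (m : ℝ)) * (m : ℝ) = (1 + ε) / 2 := by
          rw [div_mul_eq_mul_div, mul_comm (2 : ℝ) (m : ℝ), ← div_div, mul_div_assoc,
            div_self hm0.ne', mul_one]
        have e2 : 2 * Real.log 2 ≤ 4 * ((1 + ε) / (2 * (m : ℝ)) * Real.log q) * m := by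
          have : 4 * ((1 + ε) / (2 * (m : ℝ)) * Real.log q) * m =
              4 * ((1 + ε) / (2 * (m : ℝ)) * (m : ℝ)) * Real.log q := by ring
          rw [this, hAm]; nlinarith
        have e3 : (1 + ε) / (m : ℝ) * Real.log q = ((1 + ε) / (2 * (m : ℝ)) * Real.log q) * 2 := by
          have : (1 + ε) / (2 * (m : ℝ)) * 2 = (1 + ε) / (m : ℝ) := by
            rw [mul_comm (2 : ℝ) (m : ℝ), ← div_div, div_mul_cancel₀ _ (two_ne_zero' ℝ)]
          rw [← this]; ring
        nlinarith [e1, e2, e3, mul_pos hεa hlogq0]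
      -- `η^{1/m} ≤ η ≤ η₀`
      have hη1 : (1 : ℝ) ≤ η := by linarith
      have hηm : η ^ ((1 : ℝ) / m) ≤ η₀ := by
        calc η ^ ((1 : ℝ) / m) ≤ η ^ (1 : ℝ) :=
              Real.rpow_le_rpow_of_exponent_le hη1 (by
                rw [div_le_iff₀ hm0]; linarith)
          _ = η := Real.rpow_one η
          _ ≤ η₀ := hη'.le
      have hfin : 5 * (m : ℝ) ≤ 10 * η₀ * m / η ^ ((1 : ℝ) / m) := by
        rw [le_div_iff₀ hηm0]
        nlinarith [mul_le_mul_of_nonneg_left hηm (by positivity : (0 : ℝ) ≤ 5 * m)]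
      calc exceptionalPrimeHarmonicSum χ ((q : ℝ) ^ ((1 + ε) / (2 * (m : ℝ))))
            ((q : ℝ) ^ ((1 + ε) / (2 * ((m : ℝ) - 1))))
          ≤ 5 * m := ht.trans hstep
        _ ≤ 10 * η₀ * m / η ^ ((1 : ℝ) / m) := hfin
        _ ≤ max (max K₁ K₂) (10 * η₀) * m / η ^ ((1 : ℝ) / m) := by
          gcongr

/-! ### Matomäki–Merikoski's Lemma 2.2 (appended) -/

/-- The `z`-rough harmonic sum of `SiegelZeroExceptionalPrimeSums.lean` equals the sum of
`SiegelZeroLacunaryDivisorSums.lean`: for `z > 0`, on `m ≥ ⌈z⌉ ≥ 1` the conditions "every prime factor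
of `m` is `≥ z`" and `(m, P(z)) = 1` agree, and `rDivisorSum χ m = RealChar.charDivisorSum χ m`.
[cite: MatomakiMerikoski2023, Lemma 2.2 (left side); §2] -/
theorem roughLambdaHarmonicSum_eq_sum_coprime {q : ℕ} [NeZero q] (χ : DirichletCharacter ℂ q)
    {z : ℝ} (hz : 0 < z) (Y : ℝ) :
    roughLambdaHarmonicSum χ z Y =
      ∑ m ∈ (Icc ⌈z⌉₊ ⌊Y⌋₊).filter
          (fun m : ℕ => m.Coprime (Literature.NumberTheory.Sieve.primesProdBelow z)),
        RealChar.charDivisorSum χ m / m := by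
  unfold roughLambdaHarmonicSum
  have hfilter : (Icc ⌈z⌉₊ ⌊Y⌋₊).filter (fun m : ℕ => ∀ p ∈ m.primeFactors, z ≤ (p : ℝ)) =
      (Icc ⌈z⌉₊ ⌊Y⌋₊).filter
        (fun m : ℕ => m.Coprime (Literature.NumberTheory.Sieve.primesProdBelow z)) := by
    refine Finset.filter_congr fun m hm => ?_
    rw [Finset.mem_Icc] at hm
    have hm0 : m ≠ 0 := by
      have : 1 ≤ ⌈z⌉₊ := Nat.one_le_iff_ne_zero.mpr (by
        intro h; rw [Nat.ceil_eq_zero] at h; linarith)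
      omega
    rw [Literature.NumberTheory.Sieve.coprime_primesProdBelow_iff]
    constructor
    · intro h p hp hdvd
      have hpr := Nat.prime_of_mem_primesBelow hp
      have hlt : (p : ℝ) < z := by
        have := (Nat.mem_primesBelow.mp hp).1
        exact_mod_cast (Nat.lt_ceil.mp this)
      have hle := h p (Nat.mem_primeFactors.mpr ⟨hpr, hdvd, hm0⟩)
      linarith
    · intro h p hp
      obtain ⟨hpr, hdvd, -⟩ := Nat.mem_primeFactors.mp hp
      by_contra hlt
      have hlt' : (p : ℝ) < z := lt_of_not_ge hlt
      exact h p (Nat.mem_primesBelow.mpr ⟨Nat.lt_ceil.mpr hlt', hpr⟩) hdvd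
  rw [hfilter]
  refine Finset.sum_congr rfl fun m _ => ?_
  rw [RealChar.charDivisorSum_apply, rDivisorSum]
  congr 1
  exact Finset.sum_congr rfl fun d hd =>
    (DirichletAbel.reChar_apply χ (Nat.pos_of_mem_divisors hd).ne').symm

/-- **Matomäki–Merikoski 2023, Lemma 2.2 — DISCHARGED** (from the tree's theorem
`SiegelZero.MatomakiMerikoski2023_lemma22`, `SiegelZeroLacunaryDivisorSums.lean`).
[cite: MatomakiMerikoski2023, Lemma 2.2] -/
theorem matomakiMerikoski2023_lemma22_holds : matomakiMerikoski2023_lemma22 := by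
  obtain ⟨K, _, H⟩ := SiegelZero.MatomakiMerikoski2023_lemma22
  refine ⟨K, fun q _ χ hq _ hprim hquad η hη h0 v hv Y hY => ?_⟩
  have hz : 0 < (q : ℝ) ^ v := Real.rpow_pos_of_pos (by exact_mod_cast (by omega : 0 < q)) v
  rw [roughLambdaHarmonicSum_eq_sum_coprime χ hz]
  exact H q χ hprim hquad η hη h0 v hv Y hY

end Literature.NumberTheory.LFunctions
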